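import Summits.NavierStokesRegularity.NavierStokesRegularity.Theorems.CoriolisHeadTypeIRateOfThirdOrderDecay
import HarnessLib

/-!
# CoriolisHeadTypeIRateOfScaleNaturalDecayThree — crux `NoCoRotatingCore` (stmt-NavierStokesRegularity-22676),
# line `far_field_constancy` v2 (skeleton 15c9a82ad206abb9): **K1a₃ ⟹ K1c verbatim** (the reshape, ready to paste)

For the planner (ns-idea-10).  `typeIRate_of_third_order_decay` (landed) closes K1c under the extra hypothesis
`‖D(ΔU)(y)‖ ≤ C₃/‖y‖²`.  This file restates that hypothesis in the skeleton's own currency — scale-natural decay to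
THIRD order, `‖y‖‖DU‖ + ‖y‖²‖D²U‖ + ‖y‖³‖D³U‖ → 0` (K1a₃ := the registered K1a `stub_scaleNaturalDecay` with one
more term) — via `‖D(Δv)(x)‖ ≤ 3‖D³v(x)‖` (`norm_fderiv_laplacian_le_three_mul`), and proves

* `typeIRate_of_scaleNaturalDecay_three`: the K1c hypotheses + `‖y‖³‖D³U(y)‖ → 0` ⟹ the Type-I rate;
* `stub_typeIRate_of_scaleNaturalDecay_three`: **K1a₃ (as a closed statement, the registered K1a signature with the
  third-order term added) ⟹ the registered signature of `stub_typeIRate` VERBATIM**.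

So a reshaped skeleton with stubs {K1a₃, R1 = `stub_pineauVicolConjecture`} composes: K1b is landed
(`FarFieldLimit.stub_farFieldLimit`, seat ns-s29-p2), K1c := `stub_typeIRate_of_scaleNaturalDecay_three K1a₃`, K1a :=
K1a₃ minus a term.  HONEST FRAMING: K1a₃ (like K1a) is OPEN — it is the hard core of the line; nothing here proves
`NoCoRotatingCore`, Pineau–Vicol's Conjecture 1.1 or Navier–Stokes regularity.

References: skeleton `Cruxes/NoCoRotatingCore/Lines/far_field_constancy.lean` (stubs K1a, K1c); B. Pineau, V. Vicol,
arXiv:2607.09619 (2026), Conj. 1.1, Prop. 3.1, Rem. 1.3 [PineauVicol2026].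
-/

noncomputable section

open Set Function Filter Topology Metric InnerProductSpace Real
open scoped RealInnerProductSpace Laplacian ContDiff

-- the summit and its single sub-problem share the name (CONVENTIONS §1), as in every Theorems file
set_option linter.dupNamespace false

namespace Summit.NavierStokesRegularity.NavierStokesRegularity.Theorems.CoriolisHead

namespace TypeIRate

open Literature.Analysis.FluidPDE

/-! ## `‖D(Δv)‖ ≤ 3‖D³v‖` -/

/-- `‖Dⁿ(∂_a v)(x)‖ ≤ ‖a‖ ‖Dⁿ⁺¹v(x)‖` for any direction `a` (the slice `∂_a v = (· a) ∘ Dv` is `Dv` composed with a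
linear map of norm `≤ ‖a‖`; general-direction twin of the tree's `norm_iteratedFDeriv_fderiv_apply_basisFun_le`).
[folklore] -/
theorem norm_iteratedFDeriv_fderiv_apply_le {F : Type*} [NormedAddCommGroup F] [NormedSpace ℝ F]
    {v : EuclideanSpace ℝ (Fin 3) → F} {N : ℕ∞}
    (hv : ContDiff ℝ N v) (n : ℕ) (hn : (n : ℕ∞) + 1 ≤ N) (x a : EuclideanSpace ℝ (Fin 3)) :
    ‖iteratedFDeriv ℝ n (fun y => fderiv ℝ v y a) x‖ ≤ ‖a‖ * ‖iteratedFDeriv ℝ (n + 1) v x‖ := by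
  set A : (EuclideanSpace ℝ (Fin 3) →L[ℝ] F) →L[ℝ] F := ContinuousLinearMap.apply ℝ F a with hA
  have hfun : (fun y => fderiv ℝ v y a) = A ∘ (fderiv ℝ v) := by
    funext y; simp [hA]
  have hD : ContDiff ℝ n (fderiv ℝ v) := hv.fderiv_right (m := n) (by exact_mod_cast hn)
  rw [hfun, A.iteratedFDeriv_comp_left hD.contDiffAt (i := n) (by exact_mod_cast le_rfl),
    ← norm_iteratedFDeriv_fderiv]
  refine (ContinuousLinearMap.norm_compContinuousMultilinearMap_le _ _).trans ?_
  have hA1 : ‖A‖ ≤ ‖a‖ := by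
    rw [hA]
    refine ContinuousLinearMap.opNorm_le_bound _ (norm_nonneg _) fun L => ?_
    rw [ContinuousLinearMap.apply_apply, mul_comm]
    exact L.le_opNorm a
  exact mul_le_mul_of_nonneg_right hA1 (norm_nonneg _)

/-- **`‖D(Δv)(x)‖ ≤ 3‖D³v(x)‖`** for a `C³` field on `ℝ³`: `∂_a Δv = Δ(∂_a v)` (tree
`fderiv_laplacian_apply_of_contDiff_three`), `‖Δw‖ ≤ 3‖D²w‖` (tree), and `‖D²(∂_a v)‖ ≤ ‖a‖‖D³v‖`. [folklore] -/
theorem norm_fderiv_laplacian_le_three_mul {v : EuclideanSpace ℝ (Fin 3) → EuclideanSpace ℝ (Fin 3)}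
    (hv : ContDiff ℝ 3 v) (x : EuclideanSpace ℝ (Fin 3)) :
    ‖fderiv ℝ (Δ v) x‖ ≤ 3 * ‖iteratedFDeriv ℝ 3 v x‖ := by
  refine ContinuousLinearMap.opNorm_le_bound _ (by positivity) fun a => ?_
  rw [fderiv_laplacian_apply_of_contDiff_three hv x a]
  have hva : ContDiff ℝ 2 (fun y => fderiv ℝ v y a) :=
    (hv.fderiv_right (m := 2) (by norm_num)).clm_apply contDiff_const
  refine (norm_laplacian_le_three_mul_norm_iteratedFDeriv_two hva x).trans ?_
  have h := norm_iteratedFDeriv_fderiv_apply_le hv 2 (by norm_num) x a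
  calc 3 * ‖iteratedFDeriv ℝ 2 (fun y => fderiv ℝ v y a) x‖ ≤ 3 * (‖a‖ * ‖iteratedFDeriv ℝ (2 + 1) v x‖) :=
        mul_le_mul_of_nonneg_left h (by norm_num)
    _ = 3 * ‖iteratedFDeriv ℝ 3 v x‖ * ‖a‖ := by ring

/-! ## K1c from scale-natural decay to third order -/

section Profile

variable {ν a : ℝ} {B : EuclideanSpace ℝ (Fin 3) →L[ℝ] EuclideanSpace ℝ (Fin 3)}
  {U : EuclideanSpace ℝ (Fin 3) → EuclideanSpace ℝ (Fin 3)} {P : EuclideanSpace ℝ (Fin 3) → ℝ}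

/-- **K1c under third-order scale-natural decay.**  The hypotheses of the registered stub `stub_typeIRate` (K1a and
`U → b` for a bounded smooth div-free rotated Leray profile) together with `‖y‖³‖D³U(y)‖ → 0` give the Type-I rate
`‖U(y) − b‖ ≤ K/(1 + ‖y‖)`.  (`‖D(ΔU)‖ ≤ 3‖D³U‖ ≤ 3/‖y‖²` beyond the radius where `‖y‖³‖D³U‖ ≤ 1`, then
`typeIRate_of_third_order_decay`.)  K1c as registered and K1a stay OPEN. [cite: PineauVicol2026, Conj. 1.1, Prop. 3.1] -/
theorem typeIRate_of_scaleNaturalDecay_three (hν : 0 < ν) (ha : 0 < a)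
    (hB : ∀ x, inner ℝ (B x) x = 0) (hU : ContDiff ℝ (⊤ : ℕ∞) U) (hP : ContDiff ℝ 2 P)
    (hdiv : VectorCalculus.IsDivFree U)
    (heq : ∀ y, -(ν • (Δ U) y) + a • U y + a • fderiv ℝ U y y + (B (U y) - fderiv ℝ U y (B y)) +
      convect U U y + gradient P y = 0)
    (hbdd : ∃ M : ℝ, ∀ y, ‖U y‖ ≤ M)
    (hdecay : ∀ ε : ℝ, 0 < ε → ∃ R : ℝ, ∀ y : EuclideanSpace ℝ (Fin 3), R ≤ ‖y‖ →
      ‖y‖ * ‖fderiv ℝ U y‖ + ‖y‖ ^ 2 * ‖iteratedFDeriv ℝ 2 U y‖ ≤ ε)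
    (b : EuclideanSpace ℝ (Fin 3))
    (hlim : ∀ ε : ℝ, 0 < ε → ∃ R : ℝ, ∀ y : EuclideanSpace ℝ (Fin 3), R ≤ ‖y‖ → ‖U y - b‖ ≤ ε)
    (hdecay3 : ∀ ε : ℝ, 0 < ε → ∃ R : ℝ, ∀ y : EuclideanSpace ℝ (Fin 3), R ≤ ‖y‖ →
      ‖y‖ ^ 3 * ‖iteratedFDeriv ℝ 3 U y‖ ≤ ε) :
    ∃ K : ℝ, ∀ y : EuclideanSpace ℝ (Fin 3), ‖U y - b‖ ≤ K / (1 + ‖y‖) := by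
  refine typeIRate_of_third_order_decay hν ha hB hU hP hdiv heq hbdd hdecay b hlim ?_
  obtain ⟨R₃, hR₃⟩ := hdecay3 1 one_pos
  have hU3 : ContDiff ℝ 3 U := hU.of_le (by norm_cast)
  refine ⟨3, max R₃ 1, fun y hy => ?_⟩
  have hy1 : 1 ≤ ‖y‖ := (le_max_right _ _).trans hy
  have hypos : 0 < ‖y‖ := by linarith
  have h3 := hR₃ y ((le_max_left _ _).trans hy)
  refine (norm_fderiv_laplacian_le_three_mul hU3 y).trans ?_
  rw [le_div_iff₀ (pow_pos hypos 2)]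
  have h0 : 0 ≤ ‖iteratedFDeriv ℝ 3 U y‖ := norm_nonneg _
  have h2 : ‖y‖ ^ 2 * ‖iteratedFDeriv ℝ 3 U y‖ ≤ ‖y‖ ^ 3 * ‖iteratedFDeriv ℝ 3 U y‖ := by
    have : ‖y‖ ^ 2 ≤ ‖y‖ ^ 3 := by nlinarith [pow_pos hypos 2]
    exact mul_le_mul_of_nonneg_right this h0
  nlinarith

end Profile

/-- **K1a₃ ⟹ K1c, both verbatim (the reshape of line `far_field_constancy`, ready to paste).**  IF every bounded smooth
div-free rotated Leray profile has scale-natural derivative decay TO THIRD ORDER (K1a₃: the registered signature of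
`stub_scaleNaturalDecay` with the term `‖y‖³‖D³U(y)‖` added), THEN the registered signature of `stub_typeIRate` (K1c)
holds as printed.  Proof: `typeIRate_of_scaleNaturalDecay_three`, the third-order decay of the given profile being
read off from K1a₃.  HONEST FRAMING: K1a₃ is OPEN (it contains K1a, the hard core of the line); this is a reduction,
not a proof of K1c; nothing here proves `NoCoRotatingCore` or NS regularity. [cite: PineauVicol2026, Conj. 1.1] -/
theorem stub_typeIRate_of_scaleNaturalDecay_three
    (hK1a3 : ∀ (ν a : ℝ), 0 < ν → 0 < a →
      ∀ (B : EuclideanSpace ℝ (Fin 3) →L[ℝ] EuclideanSpace ℝ (Fin 3))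
        (U : EuclideanSpace ℝ (Fin 3) → EuclideanSpace ℝ (Fin 3)) (P : EuclideanSpace ℝ (Fin 3) → ℝ),
      ContDiff ℝ (⊤ : ℕ∞) U → ContDiff ℝ 2 P → (∀ x, inner ℝ (B x) x = 0) →
      Literature.Analysis.FluidPDE.VectorCalculus.IsDivFree U →
      (∀ y, -(ν • Laplacian.laplacian U y) + a • U y + a • fderiv ℝ U y y
        + (B (U y) - fderiv ℝ U y (B y)) + Literature.Analysis.FluidPDE.convect U U y
        + gradient P y = 0) →
      (∃ M : ℝ, ∀ y, ‖U y‖ ≤ M) →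
      (∀ ε : ℝ, 0 < ε → ∃ R : ℝ, ∀ y, R ≤ ‖y‖ →
        ‖y‖ * ‖fderiv ℝ U y‖ + ‖y‖ ^ 2 * ‖iteratedFDeriv ℝ 2 U y‖ +
          ‖y‖ ^ 3 * ‖iteratedFDeriv ℝ 3 U y‖ ≤ ε)) :
    ∀ (ν a : ℝ), 0 < ν → 0 < a →
      ∀ (B : EuclideanSpace ℝ (Fin 3) →L[ℝ] EuclideanSpace ℝ (Fin 3))
        (U : EuclideanSpace ℝ (Fin 3) → EuclideanSpace ℝ (Fin 3)) (P : EuclideanSpace ℝ (Fin 3) → ℝ),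
      ContDiff ℝ (⊤ : ℕ∞) U → ContDiff ℝ 2 P → (∀ x, inner ℝ (B x) x = 0) →
      Literature.Analysis.FluidPDE.VectorCalculus.IsDivFree U →
      (∀ y, -(ν • Laplacian.laplacian U y) + a • U y + a • fderiv ℝ U y y
        + (B (U y) - fderiv ℝ U y (B y)) + Literature.Analysis.FluidPDE.convect U U y
        + gradient P y = 0) →
      (∃ M : ℝ, ∀ y, ‖U y‖ ≤ M) →
      (∀ ε : ℝ, 0 < ε → ∃ R : ℝ, ∀ y, R ≤ ‖y‖ →
        ‖y‖ * ‖fderiv ℝ U y‖ + ‖y‖ ^ 2 * ‖iteratedFDeriv ℝ 2 U y‖ ≤ ε) →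
      ∀ b : EuclideanSpace ℝ (Fin 3), (∀ ε : ℝ, 0 < ε → ∃ R : ℝ, ∀ y, R ≤ ‖y‖ → ‖U y - b‖ ≤ ε) →
      ∃ K : ℝ, ∀ y, ‖U y - b‖ ≤ K / (1 + ‖y‖) := by
  intro ν a hν ha B U P hU hP hB hdiv heq hbdd hdecay b hlim
  refine typeIRate_of_scaleNaturalDecay_three hν ha hB hU hP hdiv heq hbdd hdecay b hlim fun ε hε => ?_
  obtain ⟨R, hR⟩ := hK1a3 ν a hν ha B U P hU hP hB hdiv heq hbdd ε hε
  refine ⟨R, fun y hy => ?_⟩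
  have h := hR y hy
  have h1 : 0 ≤ ‖y‖ * ‖fderiv ℝ U y‖ := by positivity
  have h2 : 0 ≤ ‖y‖ ^ 2 * ‖iteratedFDeriv ℝ 2 U y‖ := by positivity
  linarith

end TypeIRate

end Summit.NavierStokesRegularity.NavierStokesRegularity.Theorems.CoriolisHead

end
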